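import Literature.MathematicalPhysics.QuantumLattice.Imbrie2016.A2OfLLA

/-!
# Imbrie (2016): the top-level logical skeleton of §5 — Theorem 5.1 (as a HYPOTHESIS SCHEMA, never asserted) ⟹ Corollary 5.2,
and the two contrapositive readings (L1)/(L2) used by the audit cell's DEBATE.md — REPRODUCTION (kernel-checked) of quantifier logic only

CITATION HEADER (lean-in-tree rule 2026-08-18). J. Z. Imbrie, *On many-body localization for quantum spin chains*, J. Stat. Phys.
**163** (2016) 998–1048, doi 10.1007/s10955-016-1508-x, arXiv:1403.7837 [ImbrieJSP2016], §5, verbatim: "Theorem 5.1. Fix ν > 0 and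
ε₀ > 0. Let ε = γ^{1/20} be sufficiently small. If A2(ν, ε₀) holds, then MBL holds as well." — "Clearly, we may take δ = ε̃ⁿ in (5.2)
and then A2(ν′, ε₀) holds for any ν′ < ν, provided ε₀ is small enough (depending only on C, ν, ν′). Thus we have Corollary 5.2. Let
ν, C be fixed, and let γ be sufficiently small. Assume LLA(ν, C). Then MBL holds." ("Here we use MBL as a shorthand for all of our
conclusions", §5, first paragraph; γ "sufficiently small" depends on the density bound ρ₀ of §1: "h_i, Γ_i, and J_i are independent
random variables, bounded by 1, with probability densities bounded by a fixed constant ρ₀".)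
WHAT IS TYPED: `Thm51Shape MBL` = the quantifier shape of Theorem 5.1 over the tree's typed hypotheses `A2` (eq. (5.1)) and
`Laws.Admissible ρ₀`, for an ARBITRARY predicate `MBL : Laws → ℝ → Prop` standing for "the conclusions hold for the law family at
coupling γ" (the conclusions (1.4)–(1.6) are not typed in the tree; nothing about them is assumed); `Cor52Shape MBL` = the shape of
Corollary 5.2 over `LLA` (eq. (1.3) = (5.2)).
WHAT IS PROVED (logic + the landed arrow `A2_of_LLA` with ν′ = ν/2, ε₀ = C^{−1/(ν−ν/2)}): (a) `cor52_of_thm51 : Thm51Shape MBL →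
Cor52Shape MBL` — the paper's deduction of Cor. 5.2 from Thm 5.1; (b) `not_LLA_of_not_MBL` — reading (L1) of the audit cell's
DEBATE.md §0: given Cor. 5.2, failure of the conclusions at some admissible law family and some 0 < γ ≤ γ₀(ρ₀, ν, C) refutes LLA(ν, C)
at that γ; (c) `not_LLAuniform_of_noMBL` — reading (L2): given Cor. 5.2, failure of the conclusions at EVERY γ > 0 ("no MBL phase")
refutes, for every ν > 0 and C > 0, the γ-uniform hypothesis `LLA_uniformInSmallCoupling L ν C` that Theorem 1.1 consumes.
STATUS: Theorem 5.1 is NOT asserted (it is the antecedent of every statement here); LLA, A2 and MBL are never asserted; the file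
bears on no one's truth. It makes the cell's sentence "as a matter of logic only, (L1)/(L2)" a kernel-checked one and fixes the exact
quantifier shape of T used there. Audit cell `pub-imbrie`, unit b2b-imbrie-2 gen 3 (DEBATE.md §0; SURVIVAL.md §1).
-/

noncomputable section
open _root_.MeasureTheory

namespace Literature.MathematicalPhysics.QuantumLattice.Imbrie2016

/-- The quantifier shape of **Theorem 5.1** (Imbrie 2016, §5), for an arbitrary predicate `MBL L γ` = "the conclusions hold for the
law family `L` at coupling `γ`": for every density bound ρ₀ and every ν > 0, ε₀ > 0 there is γ₀ > 0 such that for every ρ₀-admissible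
family and every 0 < γ ≤ γ₀, A2(ν, ε₀) at γ implies MBL at γ. A HYPOTHESIS SCHEMA — never asserted in the tree.
[cite: ImbrieJSP2016, Thm 5.1] -/
def Thm51Shape (MBL : Laws → ℝ → Prop) : Prop :=
  ∀ (ρ₀ ν ε₀ : ℝ), 0 < ν → 0 < ε₀ → ∃ γ₀ > 0, ∀ L : Laws, L.Admissible ρ₀ →
    ∀ γ : ℝ, 0 < γ → γ ≤ γ₀ → A2 L γ ν ε₀ → MBL L γ

/-- The quantifier shape of **Corollary 5.2** (= Theorem 1.1 as used): for every ρ₀, ν > 0, C > 0 there is γ₀ > 0 such that for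
every ρ₀-admissible family and every 0 < γ ≤ γ₀, LLA(ν, C) at γ implies MBL at γ. Never asserted. [cite: ImbrieJSP2016, Cor 5.2] -/
def Cor52Shape (MBL : Laws → ℝ → Prop) : Prop :=
  ∀ (ρ₀ ν C : ℝ), 0 < ν → 0 < C → ∃ γ₀ > 0, ∀ L : Laws, L.Admissible ρ₀ →
    ∀ γ : ℝ, 0 < γ → γ ≤ γ₀ → LLA L γ ν C → MBL L γ

/-- **Thm 5.1 ⟹ Cor 5.2** (Imbrie 2016, §5, the sentence after (5.2)), through the landed arrow `A2_of_LLA` with ν′ = ν/2 and the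
explicit ε₀ = C^(−1/(ν − ν/2)). Pure logic on top of that arrow; Thm 5.1 enters only as the hypothesis `h51`.
[cite: ImbrieJSP2016, Cor 5.2] -/
theorem cor52_of_thm51 {MBL : Laws → ℝ → Prop} (h51 : Thm51Shape MBL) : Cor52Shape MBL := by
  intro ρ₀ ν C hν hC
  obtain ⟨γ₀, hγ₀, H⟩ := h51 ρ₀ (ν / 2) (C ^ (-(1 / (ν - ν / 2)))) (by linarith) (Real.rpow_pos_of_pos hC _)
  exact ⟨γ₀, hγ₀, fun L hL γ hγ hγle hLLA => H L hL γ hγ hγle (A2_of_LLA hC (by linarith) hLLA)⟩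

/-- Reading **(L1)** of the audit cell's DEBATE.md §0, kernel-checked: GIVEN Corollary 5.2 (i.e. unless the LLA-free part of the paper
errs), a failure of the conclusions for a ρ₀-admissible family at some 0 < γ ≤ γ₀(ρ₀, ν, C) refutes LLA(ν, C) at that γ.
[cite: ImbrieJSP2016, Cor 5.2] -/
theorem not_LLA_of_not_MBL {MBL : Laws → ℝ → Prop} (h52 : Cor52Shape MBL) {ρ₀ ν C : ℝ} (hν : 0 < ν) (hC : 0 < C) :
    ∃ γ₀ > 0, ∀ L : Laws, L.Admissible ρ₀ → ∀ γ : ℝ, 0 < γ → γ ≤ γ₀ → ¬ MBL L γ → ¬ LLA L γ ν C := by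
  obtain ⟨γ₀, hγ₀, H⟩ := h52 ρ₀ ν C hν hC
  exact ⟨γ₀, hγ₀, fun L hL γ hγ hγle hnot hLLA => hnot (H L hL γ hγ hγle hLLA)⟩

/-- Reading **(L2)**, kernel-checked: GIVEN Corollary 5.2, if the conclusions fail for a ρ₀-admissible family at EVERY coupling γ > 0
("no MBL phase at any disorder"), then for every ν > 0 and C > 0 the γ-uniform hypothesis `LLA_uniformInSmallCoupling L ν C`
(LLA(ν, C) on a whole interval (0, γ₁]) is false — i.e. level attraction beyond every (ν, C) at arbitrarily small coupling, or an
error in the LLA-free part. [cite: ImbrieJSP2016, Cor 5.2] -/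
theorem not_LLAuniform_of_noMBL {MBL : Laws → ℝ → Prop} (h52 : Cor52Shape MBL) {ρ₀ : ℝ} {L : Laws} (hL : L.Admissible ρ₀)
    (hno : ∀ γ : ℝ, 0 < γ → ¬ MBL L γ) {ν C : ℝ} (hν : 0 < ν) (hC : 0 < C) :
    ¬ LLA_uniformInSmallCoupling L ν C := by
  rintro ⟨γ₁, hγ₁, hU⟩
  obtain ⟨γ₀, hγ₀, H⟩ := h52 ρ₀ ν C hν hC
  have hm : 0 < min γ₀ γ₁ := lt_min hγ₀ hγ₁
  exact hno _ hm (H L hL _ hm (min_le_left _ _) (hU _ hm (min_le_right _ _)))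

end Literature.MathematicalPhysics.QuantumLattice.Imbrie2016
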